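import Literature.NumberTheory.Transcendental.EvaluationModuleJumps
import Mathlib.LinearAlgebra.Dimension.OrzechProperty
import Mathlib.LinearAlgebra.FreeModule.Finite.Basic
import Mathlib.Tactic
import HarnessLib

/-!
# Cartesian powers of evaluation modules: dimension `(dim E)^d` and independence of the products

Calegari–Dimitrov–Tang, arXiv:2408.15403, §3.1.3 and §6.2–6.3: the auxiliary function
`F(𝐱) = Σ_{𝐢,𝐤} c_{𝐢,𝐤} 𝐱^𝐤 Π_s f_{i_s}(x_s)` (eq. (6.8)) is **non-zero as soon as some
`c_{𝐢,𝐤} ≠ 0`**, because the products `𝐱^𝐤 Π_s f_{i_s}(x_s)` (`k_s < D`) — the natural spanning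
family of the `d`-th Cartesian power `E_D^{⊗ d}` of the evaluation module — are `K`-linearly
independent when `f_1,…,f_m` are `K[x]`-linearly independent ("the `N = (m − o(1))^d D^d` unknown
coefficients `c_{𝐢,𝐤}`", proof of Lemma 61, p. 50; and `rank(E_D) = mD`, Corollary 34).
This file supplies that independence, complementing `EvaluationModuleJumps`:

* `CalegariDimitrovTang.linearIndependent_tprod_of_orders` — products of a family with pairwise
  distinct orders (the jump basis) are independent (the triangularity behind Corollary 34);
* `CalegariDimitrovTang.finrank_prodModule` — `dim_K E^{⊗d} = (dim_K E)^d`;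
* `CalegariDimitrovTang.linearIndependent_tprod_basis` — products of any basis of `E` form a
  basis of `E^{⊗d}`; `linearIndependent_tprod_X_pow_mul` — the case of `E_D` and the family
  `𝐱^𝐤 Π f_{i_s}(x_s)`; `tprod_sum_ne_zero` — `F ≠ 0` when `c ≠ 0`.

No named facts.

## References

* [CalegariDimitrovTang2024] arXiv:2408.15403, §3.1.3 Corollary 34; §6.2 eq. (6.8), §6.3 (p. 50).
-/

noncomputable section

open PowerSeries Finset

namespace Literature.NumberTheory.Transcendental

namespace CalegariDimitrovTang

variable {K : Type*} [Field K] {d : ℕ}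

/-- **Triangularity**: if `g : ι → K⟦X⟧` are non-zero with pairwise distinct orders, the products
`g_{k_1}(x_1)⋯g_{k_d}(x_d)`, `k : Fin d → ι`, are `K`-linearly independent.
[cite: CalegariDimitrovTang2024, §3.1.3 proof of Corollary 34] -/
theorem linearIndependent_tprod_of_orders {ι : Type*} [Fintype ι] (g : ι → K⟦X⟧)
    (hg : ∀ i, g i ≠ 0) (hinj : Function.Injective fun i => (g i).order.toNat) :
    LinearIndependent K (fun k : Fin d → ι => tprod (fun s => g (k s))) := by
  classical
  rw [Fintype.linearIndependent_iff]
  intro c hc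
  by_contra hne
  push Not at hne
  -- exponents
  let U : (Fin d → ι) → (Fin d →₀ ℕ) :=
    fun k => Finsupp.equivFunOnFinite.symm (fun s => (g (k s)).order.toNat)
  have hU : ∀ k s, U k s = (g (k s)).order.toNat := fun k s => rfl
  have hUinj : Function.Injective U := by
    intro k k' h
    funext s
    apply hinj
    show (g (k s)).order.toNat = (g (k' s)).order.toNat
    rw [← hU k s, ← hU k' s, h]
  have hT1 : ∀ k m, MvPowerSeries.coeff m (tprod fun s => g (k s)) ≠ 0 → ∀ s, U k s ≤ m s := by
    intro k m hkm s
    rw [coeff_tprod] at hkm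
    have hs : coeff (m s) (g (k s)) ≠ 0 := fun h => hkm (Finset.prod_eq_zero (mem_univ s) h)
    rw [hU]
    by_contra hlt
    push Not at hlt
    exact hs (coeff_of_lt_order_toNat _ hlt)
  have hT2 : ∀ k, MvPowerSeries.coeff (U k) (tprod fun s => g (k s)) ≠ 0 := by
    intro k
    rw [coeff_tprod]
    refine Finset.prod_ne_zero_iff.mpr fun s _ => ?_
    rw [hU]
    exact coeff_order (hg (k s))
  set A := (Finset.univ : Finset (Fin d → ι)).filter (fun k => c k ≠ 0) with hA
  have hAne : A.Nonempty := by
    obtain ⟨k, hk⟩ := hne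
    exact ⟨k, Finset.mem_filter.mpr ⟨mem_univ k, hk⟩⟩
  obtain ⟨k₁, hk₁A, hk₁min⟩ := A.exists_min_image (fun k => (U k).degree) hAne
  have hck₁ : c k₁ ≠ 0 := (Finset.mem_filter.mp hk₁A).2
  have hcoeff := congrArg (MvPowerSeries.coeff (U k₁)) hc
  rw [map_sum, map_zero] at hcoeff
  simp_rw [map_smul, smul_eq_mul] at hcoeff
  rw [Finset.sum_eq_single k₁] at hcoeff
  · exact mul_ne_zero hck₁ (hT2 k₁) hcoeff
  · intro k _ hkk₁
    by_cases hck : c k = 0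
    · rw [hck, zero_mul]
    · by_contra hne'
      have hne'' : MvPowerSeries.coeff (U k₁) (tprod fun s => g (k s)) ≠ 0 :=
        fun h => hne' (by rw [h, mul_zero])
      have hle := hT1 k (U k₁) hne''
      have hdeg : (U k₁).degree ≤ (U k).degree := hk₁min k (Finset.mem_filter.mpr ⟨mem_univ k, hck⟩)
      exact hkk₁ (hUinj (Finsupp.eq_of_le_of_degree_eq hle hdeg)).symm
  · intro h; exact absurd (mem_univ k₁) h

/-- The Cartesian power is finite-dimensional. [folklore] -/
instance finiteDimensional_prodModule (E : Submodule K K⟦X⟧) [FiniteDimensional K E] (d : ℕ) :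
    FiniteDimensional K (prodModule E d) := by
  classical
  haveI : Fintype (jumps E) := (jumps_finite E).fintype
  obtain ⟨b, -⟩ := exists_basis_order_eq E
  have h := prodModule_le_span_basis b d
  haveI : FiniteDimensional K (Submodule.span K (Set.range fun k : Fin d → jumps E =>
      tprod (fun s => ((b (k s) : E) : K⟦X⟧)))) :=
    FiniteDimensional.span_of_finite K (Set.finite_range _)
  exact Submodule.finiteDimensional_of_le h

/-- **`dim E^{⊗d} = (dim E)^d`.** [cite: CalegariDimitrovTang2024, §3.1.3 (proof of Corollary 34:
"`rank(E_D^{⊗d}) = (mD)^d`")] -/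
theorem finrank_prodModule (E : Submodule K K⟦X⟧) [FiniteDimensional K E] (d : ℕ) :
    Module.finrank K (prodModule E d) = (Module.finrank K E) ^ d := by
  classical
  haveI : Fintype (jumps E) := (jumps_finite E).fintype
  obtain ⟨b, hb⟩ := exists_basis_order_eq E
  have hcard : Fintype.card (jumps E) = Module.finrank K E := (Module.finrank_eq_card_basis b).symm
  set T : (Fin d → jumps E) → MvPowerSeries (Fin d) K :=
    fun k => tprod (fun s => ((b (k s) : E) : K⟦X⟧)) with hT
  have hli : LinearIndependent K T :=
    linearIndependent_tprod_of_orders (fun l : jumps E => ((b l : E) : K⟦X⟧)) (fun l => (hb l).1)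
      (fun l l' h => Subtype.ext (by rw [← (hb l).2, ← (hb l').2]; exact h))
  have hspan : Submodule.span K (Set.range T) = prodModule E d := by
    apply le_antisymm
    · exact Submodule.span_le.mpr (by rintro _ ⟨k, rfl⟩; exact tprod_mem_prodModule fun s => (b (k s)).2)
    · exact prodModule_le_span_basis b d
  rw [← hspan, finrank_span_eq_card hli, Fintype.card_fun, Fintype.card_fin, hcard]

/-- **Products of a basis form a basis of the Cartesian power**: for any basis `b` of `E`, the
family `k ↦ b_{k_1}(x_1)⋯b_{k_d}(x_d)` is `K`-linearly independent (and spans `E^{⊗d}` by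
`prodModule_le_span_basis`). [folklore] -/
theorem linearIndependent_tprod_basis {ι : Type*} [Fintype ι] {E : Submodule K K⟦X⟧}
    (b : Module.Basis ι K E) :
    LinearIndependent K (fun k : Fin d → ι => tprod (fun s => ((b (k s) : E) : K⟦X⟧))) := by
  classical
  haveI : FiniteDimensional K E := Module.Finite.of_basis b
  rw [linearIndependent_iff_card_eq_finrank_span]
  have hspan : Submodule.span K (Set.range fun k : Fin d → ι => tprod (fun s => ((b (k s) : E) : K⟦X⟧))) =
      prodModule E d := by
    apply le_antisymm
    · exact Submodule.span_le.mpr (by rintro _ ⟨k, rfl⟩; exact tprod_mem_prodModule fun s => (b (k s)).2)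
    · exact prodModule_le_span_basis b d
  rw [Set.finrank, hspan, finrank_prodModule, Module.finrank_eq_card_basis b, Fintype.card_fun,
    Fintype.card_fin]

variable {m : ℕ}

/-- **The products `𝐱^𝐤 Π_s f_{i_s}(x_s)` (`k_s < D`) are `K`-linearly independent** when
`f_1,…,f_m` are `K[x]`-linearly independent. [cite: CalegariDimitrovTang2024, §6.3 (p. 50), with
§3.1.3 Corollary 34] -/
theorem linearIndependent_tprod_X_pow_mul (f : Fin m → K⟦X⟧) (hf : LinearIndependent (Polynomial K) f)
    (D d : ℕ) :
    LinearIndependent K (fun κ : Fin d → Fin m × Fin D =>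
      tprod (fun s => (X : K⟦X⟧) ^ ((κ s).2 : ℕ) * f (κ s).1)) := by
  have hli := linearIndependent_X_pow_mul f hf D
  set b := Module.Basis.span hli with hb
  have key := linearIndependent_tprod_basis (d := d) b
  have hfam : (fun κ : Fin d → Fin m × Fin D => tprod (fun s => ((b (κ s) : _) : K⟦X⟧))) =
      fun κ => tprod (fun s => (X : K⟦X⟧) ^ ((κ s).2 : ℕ) * f (κ s).1) := by
    funext κ
    congr 1
    funext s
    rw [hb, Module.Basis.span_apply]
  rw [hfam] at key
  exact key

/-- Hence the auxiliary function `F = Σ_κ c_κ · 𝐱^𝐤 Π f_{i_s}(x_s)` is non-zero as soon as some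
coefficient is. [cite: CalegariDimitrovTang2024, §6.2 eq. (6.8), §6.3 (p. 50)] -/
theorem tprod_sum_ne_zero (f : Fin m → K⟦X⟧) (hf : LinearIndependent (Polynomial K) f) (D d : ℕ)
    {c : (Fin d → Fin m × Fin D) → K} (hc : c ≠ 0) :
    ∑ κ, c κ • tprod (fun s => (X : K⟦X⟧) ^ ((κ s).2 : ℕ) * f (κ s).1) ≠ 0 := by
  intro h0
  exact hc (funext fun κ => Fintype.linearIndependent_iff.mp
    (linearIndependent_tprod_X_pow_mul f hf D d) c h0 κ)

end CalegariDimitrovTang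

end Literature.NumberTheory.Transcendental
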